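import Summits.QuantumFields.YangMills.Theorems.AllWindowsColdBoxBoxHighLineTiltCum3Bound
import Summits.QuantumFields.YangMills.Theorems.AllWindowsColdBoxBoxHighLineTiltTruncation

/-!
# T-S5.13 (e4) for the ACTUAL letters — `κ₃,₀(c_x, c_y, tiltU)` on `μ_D` is bounded by four Hölder sizes

Instantiation of ✓`Tilt.abs_tiltCum3_muD_zero_le` (…TiltCum3Bound) with the chart plaquette costs `c_x = chartPlaqCost H x 1 2 = E_x + O_x` (`O_x = chartPlaqCostOdd`,
`E_x = c_x − O_x` even) and the tilt exponent `tiltU β H = U_e + U_o` split into its even/odd parts `U_e(a) = (U(a)+U(−a))/2`, `U_o(a) = (U(a)−U(−a))/2` (no Taylor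
input needed for the split itself; ✓`GaussNormalForm.measurable_tiltU`, ✓`EdgeChartGaussian.measurable_chartPlaqCost(_Odd)`; `|c| ≤ 4` ✓`PlaqObsL2.abs_chartPlaqCost_le`;
`|tiltU| ≤ B` on the small-field set is the ✓13s hypothesis, the set being symmetric ✓`neg_mem_smallField_iff`):

  ★`abs_tiltCum3_muD_zero_chartPlaqCost_le`:  |κ₃,₀(c_x, c_y, tiltU β H)| ≤ T(Ẽ_x,Ẽ_y,Ũ_e) + T(Ẽ_x,O_y,U_o) + T(O_x,Ẽ_y,U_o) + T(O_x,O_y,Ũ_e).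

Tree (✓TiltCum3Bound, ✓TiltTruncation) + Mathlib; no definitions.  HONEST LABEL: bookkeeping for the T-S5.13 assembly of the XL stub S5 of a critic-PASSed DRAFT line; T-S5.13/S5,
U5, ⟨24004⟩ ⟨24335⟩ ⟨24336⟩ remain OPEN; route AllWindowsColdBox is DRAFT; no rung is proved; the Yang–Mills mass gap is NOT proved by this file.
Seat ym-line-sfw-p2 g77 (LEAD, cell ym-idea-1; T-S5.13 assembler of record).
-/

set_option autoImplicit false

noncomputable section

open MeasureTheory Set
open scoped ENNReal
open Literature.Probability.LatticeModels (Site)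

namespace Summit.QuantumFields.YangMills.Theorems.AllWindowsColdBoxBoxHighLine

namespace Tilt

variable (H : ℕ)

/-- At `t = 0` the tilted expectation does not depend on the exponent. -/
theorem tiltExp_zero_indep {Ω : Type*} [MeasurableSpace Ω] (μ : Measure Ω) (U U' : Ω → ℝ) (G : Ω → ℝ) :
    tiltExp μ U 0 G = tiltExp μ U' 0 G := by
  simp only [tiltExp, zero_mul, Real.exp_zero, mul_one]

/-- ★ **(e4) for the actual letters.**  For `0 < β`, `D = smallField H s` of positive Gaussian mass, `|tiltU β H| ≤ B` on `D` with `8 ≤ B`, and sites `x, y`: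
`|κ₃,₀(c_x, c_y, tiltU)| ≤ T(Ẽ_x,Ẽ_y,Ũ_e) + T(Ẽ_x,O_y,U_o) + T(O_x,Ẽ_y,U_o) + T(O_x,O_y,Ũ_e)` over `μ_D`, with `E = c − c^{odd}`, `U_e, U_o` the even/odd parts of `tiltU`,
centrings `Ẽ = E − E_0[E]`, `Ũ_e = U_e − E_0[U_e]`, and `T(X,Y,Z) = √(√E_0[X⁴]·√E_0[Y⁴])·√E_0[Z²]`. -/
theorem abs_tiltCum3_muD_zero_chartPlaqCost_le {β : ℝ} (hβ : 0 < β) (s : ℝ) (hD : 0 < ∫ a, sfInd H s a * gaussWeight β H a) (x y : Site 4)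
    {B : ℝ} (hB : 8 ≤ B) (hU : ∀ a ∈ smallField H s, |tiltU β H a| ≤ B) :
    let μD : Measure (LandauFree H → E3) := (volume.restrict (smallField H s)).withDensity fun a => ENNReal.ofReal (gaussWeight β H a)
    let E₁ : (LandauFree H → E3) → ℝ := fun a => chartPlaqCost H x 1 2 a - chartPlaqCostOdd H x 1 2 a
    let E₂ : (LandauFree H → E3) → ℝ := fun a => chartPlaqCost H y 1 2 a - chartPlaqCostOdd H y 1 2 a
    let Ue : (LandauFree H → E3) → ℝ := fun a => (tiltU β H a + tiltU β H (-a)) / 2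
    let Uo : (LandauFree H → E3) → ℝ := fun a => (tiltU β H a - tiltU β H (-a)) / 2
    let T : ((LandauFree H → E3) → ℝ) → ((LandauFree H → E3) → ℝ) → ((LandauFree H → E3) → ℝ) → ℝ := fun X Y Z =>
      Real.sqrt (Real.sqrt (tiltExp μD (tiltU β H) 0 (fun a => X a ^ 4)) * Real.sqrt (tiltExp μD (tiltU β H) 0 (fun a => Y a ^ 4))) *
        Real.sqrt (tiltExp μD (tiltU β H) 0 (fun a => Z a ^ 2))
    |tiltCum3 μD (tiltU β H) 0 (chartPlaqCost H x 1 2) (chartPlaqCost H y 1 2)| ≤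
      T (fun a => E₁ a - tiltExp μD (tiltU β H) 0 E₁) (fun a => E₂ a - tiltExp μD (tiltU β H) 0 E₂) (fun a => Ue a - tiltExp μD (tiltU β H) 0 Ue) +
      T (fun a => E₁ a - tiltExp μD (tiltU β H) 0 E₁) (chartPlaqCostOdd H y 1 2) Uo +
      T (chartPlaqCostOdd H x 1 2) (fun a => E₂ a - tiltExp μD (tiltU β H) 0 E₂) Uo +
      T (chartPlaqCostOdd H x 1 2) (chartPlaqCostOdd H y 1 2) (fun a => Ue a - tiltExp μD (tiltU β H) 0 Ue) := by
  intro μD E₁ E₂ Ue Uo T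
  have hB0 : 0 ≤ B := by linarith
  -- the splits as function identities
  have hUsplit : tiltU β H = fun a => Ue a + Uo a := funext fun a => by simp only [Ue, Uo]; ring
  have hc₁ : chartPlaqCost H x 1 2 = fun a => E₁ a + chartPlaqCostOdd H x 1 2 a := funext fun a => by simp only [E₁]; ring
  have hc₂ : chartPlaqCost H y 1 2 = fun a => E₂ a + chartPlaqCostOdd H y 1 2 a := funext fun a => by simp only [E₂]; ring
  -- measurability
  have mc₁ := EdgeChartGaussian.measurable_chartPlaqCost H x 1 2
  have mc₂ := EdgeChartGaussian.measurable_chartPlaqCost H y 1 2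
  have mO₁ := EdgeChartGaussian.measurable_chartPlaqCostOdd H x 1 2
  have mO₂ := EdgeChartGaussian.measurable_chartPlaqCostOdd H y 1 2
  have mE₁ : Measurable E₁ := mc₁.sub mO₁
  have mE₂ : Measurable E₂ := mc₂.sub mO₂
  have mU : Measurable (tiltU β H) := GaussNormalForm.measurable_tiltU β H
  have mUn : Measurable fun a : LandauFree H → E3 => tiltU β H (-a) := mU.comp measurable_neg
  have mUe : Measurable Ue := (mU.add mUn).div_const 2
  have mUo : Measurable Uo := (mU.sub mUn).div_const 2
  -- bounds on D
  have bO₁ : ∀ a ∈ smallField H s, |chartPlaqCostOdd H x 1 2 a| ≤ B := fun a _ => (PlaqObsL2.abs_chartPlaqCostOdd_le_four H x 1 2 a).trans (by linarith)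
  have bO₂ : ∀ a ∈ smallField H s, |chartPlaqCostOdd H y 1 2 a| ≤ B := fun a _ => (PlaqObsL2.abs_chartPlaqCostOdd_le_four H y 1 2 a).trans (by linarith)
  have bE₁ : ∀ a ∈ smallField H s, |E₁ a| ≤ B := fun a _ => by
    have h := (abs_sub _ _).trans (add_le_add (PlaqObsL2.abs_chartPlaqCost_le H x 1 2 a) (PlaqObsL2.abs_chartPlaqCostOdd_le_four H x 1 2 a))
    exact h.trans (by linarith)
  have bE₂ : ∀ a ∈ smallField H s, |E₂ a| ≤ B := fun a _ => by
    have h := (abs_sub _ _).trans (add_le_add (PlaqObsL2.abs_chartPlaqCost_le H y 1 2 a) (PlaqObsL2.abs_chartPlaqCostOdd_le_four H y 1 2 a))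
    exact h.trans (by linarith)
  have bUe : ∀ a ∈ smallField H s, |Ue a| ≤ B := fun a ha => by
    have h1 := hU a ha
    have h2 := hU (-a) ((EdgeChartGaussian.neg_mem_smallField_iff s a).2 ha)
    simp only [Ue]
    rw [abs_div, abs_two]
    have := abs_add_le (tiltU β H a) (tiltU β H (-a))
    linarith
  have bUo : ∀ a ∈ smallField H s, |Uo a| ≤ B := fun a ha => by
    have h1 := hU a ha
    have h2 := hU (-a) ((EdgeChartGaussian.neg_mem_smallField_iff s a).2 ha)
    simp only [Uo]
    rw [abs_div, abs_two]
    have := abs_sub (tiltU β H a) (tiltU β H (-a))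
    linarith
  -- parities
  have pO₁ : ∀ a, chartPlaqCostOdd H x 1 2 (-a) = -chartPlaqCostOdd H x 1 2 a := EdgeChartGaussian.chartPlaqCostOdd_neg x 1 2
  have pO₂ : ∀ a, chartPlaqCostOdd H y 1 2 (-a) = -chartPlaqCostOdd H y 1 2 a := EdgeChartGaussian.chartPlaqCostOdd_neg y 1 2
  have pE₁ : ∀ a, E₁ (-a) = E₁ a := fun a => by simp only [E₁, chartPlaqCostOdd, neg_neg]; ring
  have pE₂ : ∀ a, E₂ (-a) = E₂ a := fun a => by simp only [E₂, chartPlaqCostOdd, neg_neg]; ring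
  have pUe : ∀ a, Ue (-a) = Ue a := fun a => by simp only [Ue, neg_neg]; ring
  have pUo : ∀ a, Uo (-a) = -Uo a := fun a => by simp only [Uo, neg_neg]; ring
  -- instantiate the abstract bound
  have h := abs_tiltCum3_muD_zero_le H hβ s hD hB0 mE₁ mO₁ mE₂ mO₂ mUe mUo bE₁ bO₁ bE₂ bO₂ bUe bUo pE₁ pO₁ pE₂ pO₂ pUe pUo
  simp only at h
  simp only [T, μD]
  rw [hc₁, hc₂, hUsplit]
  exact h

end Tilt

end Summit.QuantumFields.YangMills.Theorems.AllWindowsColdBoxBoxHighLine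

end
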